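import Summits.HodgeConjecture.HodgeCM.PerL34.FockInfinitesimalAction_1

/-! PORT of `HodgeCM/PerL34/FockInfinitesimalAction.lean` (HodgeCMPerL run 82) — part 2: continuation of `Summits.HodgeConjecture.HodgeCM.PerL34.FockInfinitesimalAction_1` (split at a top-level declaration boundary by port_pkg.py; scope re-opened below; declarations unchanged). -/

-- port_pkg: scope re-opened for this part (file-level context, then the namespace/section stack open at the cut)
set_option autoImplicit false
open MvPolynomial Complex MeasureTheory
open scoped Real InnerProductSpace Matrix ComplexConjugate
namespace HodgeCM.PerL34.Fock.Hermite
noncomputable section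
variable {σ : Type*} [Fintype σ] [DecidableEq σ]
section Unitary
variable {γ : ℝ → Matrix.unitaryGroup σ ℂ} {X : Matrix σ σ ℂ} {t₀ : ℝ}
/-- **`dν₀` along a path.**  Let `γ : ℝ → U(σ)` be entrywise differentiable at `t₀` with velocity `X`.  Then for
every polynomial `F`, `t ↦ ν₀(γ t)(F·e^{−(π/2)|z|²})` is differentiable at `t₀` IN THE FOCK SPACE `𝓕 ⊂ L²(ℂ^σ)`,
with derivative `(dirDeriv (γ t₀)ᴴ Xᴴ F)·e^{−(π/2)|z|²}` — the chain rule through [Fo89 Prop (4.39)]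
`ν₀(U)F = F ∘ U⁻¹ = F ∘ Uᴴ`. -/
theorem hasDerivAt_fockRep_path (hγ : ∀ j k, HasDerivAt (fun t => (γ t : Matrix σ σ ℂ) j k) (X j k) t₀)
    (F : MvPolynomial σ ℂ) :
    HasDerivAt (fun t => fockRep (γ t) (fockToL2 F))
      (fockToL2 (dirDeriv (star (γ t₀ : Matrix σ σ ℂ)) (star X) F)) t₀ := by
  simp_rw [fockRep_fockToL2]
  exact hasDerivAt_fockToL2_linSubst (P := fun t => star (γ t : Matrix σ σ ℂ))
    (fun j k => by simpa only [Matrix.star_apply] using (hγ k j).star) F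

/-- **Velocities of unitary paths at `1` are skew-Hermitian**: differentiating `(γ t)ᴴ (γ t) = 1` at a time
`t₀` with `γ t₀ = 1` gives `Xᴴ + X = 0`. -/
theorem star_eq_neg_of_hasDerivAt_unitaryGroup
    (hγ : ∀ j k, HasDerivAt (fun t => (γ t : Matrix σ σ ℂ) j k) (X j k) t₀) (h1 : γ t₀ = 1) :
    star X = -X := by
  ext j k
  have hconst : ∀ t, ∑ l, star ((γ t : Matrix σ σ ℂ) l j) * (γ t : Matrix σ σ ℂ) l k
      = (1 : Matrix σ σ ℂ) j k := fun t => by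
    have h := congr_fun (congr_fun (Matrix.UnitaryGroup.star_mul_self (γ t)) j) k
    rw [Matrix.mul_apply] at h
    simpa only [Matrix.star_apply] using h
  have hd : HasDerivAt (fun t => ∑ l, star ((γ t : Matrix σ σ ℂ) l j) * (γ t : Matrix σ σ ℂ) l k)
      (∑ l, (star (X l j) * (γ t₀ : Matrix σ σ ℂ) l k + star ((γ t₀ : Matrix σ σ ℂ) l j) * X l k)) t₀ :=
    HasDerivAt.fun_sum fun l _ => (hγ l j).star.fun_mul (hγ l k)
  have h0 : HasDerivAt (fun t => ∑ l, star ((γ t : Matrix σ σ ℂ) l j) * (γ t : Matrix σ σ ℂ) l k)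
      (0 : ℂ) t₀ := by
    simp_rw [hconst]
    exact hasDerivAt_const t₀ _
  have hsum := hd.unique h0
  rw [h1, OneMemClass.coe_one] at hsum
  have hsum' : star (X k j) + X j k = 0 := by
    rw [← hsum, eq_comm]
    have hl : ∀ l : σ, star (X l j) * (1 : Matrix σ σ ℂ) l k + star ((1 : Matrix σ σ ℂ) l j) * X l k
        = (if l = k then star (X k j) else 0) + (if l = j then X j k else 0) := fun l => by
      by_cases hlk : l = k
      · subst hlk
        by_cases hlj : l = j
        · subst hlj
          simp [Matrix.one_apply_eq]
        · simp [Matrix.one_apply_eq, Matrix.one_apply_ne hlj, hlj]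
      · by_cases hlj : l = j
        · subst hlj
          simp [Matrix.one_apply_eq, Matrix.one_apply_ne hlk, hlk]
        · simp [Matrix.one_apply_ne hlk, Matrix.one_apply_ne hlj, hlk, hlj]
    simp_rw [hl]
    rw [Finset.sum_add_distrib, Finset.sum_ite_eq' Finset.univ k, Finset.sum_ite_eq' Finset.univ j,
      if_pos (Finset.mem_univ _), if_pos (Finset.mem_univ _)]
  rw [Matrix.star_apply, Matrix.neg_apply]
  exact eq_neg_of_add_eq_zero_left hsum'

/-- **`dΓ(X)` is the infinitesimal generator of `ν₀`.**  If `γ : ℝ → U(σ)` is entrywise differentiable at `t₀`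
with velocity `X` and `γ t₀ = 1`, then (`X` is skew-Hermitian and) for every polynomial `F`,
`d/dt|_{t₀} ν₀(γ t)(F·e^{−(π/2)|z|²}) = (dΓ(X) F)·e^{−(π/2)|z|²}` in `𝓕`, where
`dΓ(X) F = −Σ_{j,k} X_{jk} z_k ∂_j F`. -/
theorem hasDerivAt_fockRep_path_one
    (hγ : ∀ j k, HasDerivAt (fun t => (γ t : Matrix σ σ ℂ) j k) (X j k) t₀) (h1 : γ t₀ = 1)
    (F : MvPolynomial σ ℂ) :
    HasDerivAt (fun t => fockRep (γ t) (fockToL2 F)) (fockToL2 (dGamma X F)) t₀ := by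
  have h := hasDerivAt_fockRep_path hγ F
  rw [h1, OneMemClass.coe_one, star_one, dirDeriv_one, star_eq_neg_of_hasDerivAt_unitaryGroup hγ h1,
    dGamma_neg, LinearMap.neg_apply, neg_neg] at h
  exact h

/-- The same with `deriv`. -/
theorem deriv_fockRep_path_one
    (hγ : ∀ j k, HasDerivAt (fun t => (γ t : Matrix σ σ ℂ) j k) (X j k) t₀) (h1 : γ t₀ = 1)
    (F : MvPolynomial σ ℂ) :
    deriv (fun t => fockRep (γ t) (fockToL2 F)) t₀ = fockToL2 (dGamma X F) :=
  (hasDerivAt_fockRep_path_one hγ h1 F).deriv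

end Unitary

end

end HodgeCM.PerL34.Fock.Hermite
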